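import Literature.Barriers.RiemannHypothesis.TuranPartialSumsCheckStep
import HarnessLib

/-!
# Sections of `ζ` beyond `σ = 1`: soundness of the certificate checker, V (the verdict)

Barrier catalogue `Literature/Barriers/RiemannHypothesis/`, continuation of
`TuranPartialSumsCheckStep.lean`. Pure proof file (nothing is defined or asserted).

* **`check_sound`**: `check N W es = true` implies the two hypotheses of `exists_zero_of_criterion`
  (`TuranPartialSumsCriterion.lean`) for `S =` the keys of `es` and `ω = phaseOf es` — from the final
  invariant, `W² |B'|² < Rsum²` gives `W M |B(1)| < Rsum ≤ W M ∑ ρ_r`, and `2 W hn ≤ Rsum · hd` with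
  `M ρ_r < hn/hd` gives `2 ρ_r < ∑ ρ` — hence a zero of `ζ_N` with `Re s > 1`;
* `checkRange_sound`, `checkSegs_sound`, `coversGo_sound` and the form used by the certified runs
  `TuranPartialSumsRun*.lean`: **`exists_zero_of_checkSegs`** — if `checkSegs W segs = true` and
  `coversGo segs lo hi = true` then every `N ∈ [lo, hi)` has a zero of `ζ_N` with `Re s > 1`.

## References

* [PlattTrudgian2016] D. J. Platt, T. S. Trudgian, LMS J. Comput. Math. 19 (2016), §2.
-/

noncomputable section

namespace Literature.Barriers.RiemannHypothesis.TuranCheck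

open Literature.Barriers.RiemannHypothesis Complex Finset

/-! ### Soundness of the checker -/

/-- **Soundness of `check`.** If `check N W es = true` then `ζ_N` has a zero with `Re s > 1`
(through `exists_zero_of_criterion` for the keys of `es` and the phases `phaseOf es`).
[cite: PlattTrudgian2016, §2.2] -/
theorem check_sound {N W : ℕ} {es : List (ℕ × ℤ × ℤ × ℕ)} (h : check N W es = true) :
    ∃ s : ℂ, 1 < s.re ∧ zetaPartialSum N s = 0 := by
  rw [check] at h
  simp only [Bool.and_eq_true, ble_true_iff, blt_true_iff, nat_mul_eq, nat_add_eq] at h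
  obtain ⟨⟨⟨⟨hval, hsp⟩, hK⟩, hK'⟩, hrest⟩ := h
  set K := isqrt N with hKdef
  have hv : Valid es := validEntries_sound hval
  have hkeys : ∀ q ∈ es.map (·.1), q.Prime := fun q hq ↦ by
    obtain ⟨e, he, rfl⟩ := List.mem_map.1 hq
    exact hv.prime e he
  have hSall : ∀ p : ℕ, p.Prime → p * p ≤ N → p ∈ keySet es := fun p hp hpp ↦
    List.mem_toFinset.2 (smallPrimesIn_sound hsp hkeys p hp hpp)
  have hM : 0 < bigM N es := bigM_pos N es fun e he ↦ ⟨(hv.prime e he).pos, hv.den_pos e he⟩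
  set M := bigM N es with hMdef
  -- the run
  cases hgo : mainGo N W K M es N 1 0 0 [] 0 0 1 with
  | none => rw [hgo] at hrest; exact absurd hrest (by simp)
  | some st =>
    rw [hgo] at hrest
    obtain ⟨Bre, Bim, Lrev, Rsum, hn, hd⟩ := st
    simp only [Bool.and_eq_true, blt_true_iff, ble_true_iff] at hrest
    obtain ⟨hc1, hc2⟩ := hrest
    have hinv := mainGo_inv hv hSall hK hK' N 0 (by omega) (inv_zero N W K M es) hgo
    simp only [zero_add] at hinv
    obtain ⟨iB, -, -, iR, ihd, iH⟩ := hinv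
    set T := freePrimes N (keySet es) with hT
    set ω := phaseOf es with hω
    -- all free primes are `≤ N`
    have hfilt : T.filter (· ≤ N) = T :=
      Finset.filter_true_of_mem fun r hr ↦ (mem_freePrimes.1 hr).1.2
    rw [hfilt] at iR
    set P : ℝ := ∑ r ∈ T, ‖bigCoeff N ω r 1‖ with hP
    have hP0 : 0 ≤ P := Finset.sum_nonneg fun _ _ ↦ norm_nonneg _
    -- (H1)
    set b : ℝ := ‖(Bre : ℂ) + (Bim : ℂ) * I‖ with hb
    have hb2 : b ^ 2 = (normSq Bre Bim : ℝ) := norm_sq_eq_normSq Bre Bim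
    have hWb : (W : ℝ) * b < Rsum := by
      refine lt_of_pow_lt_pow_left₀ 2 (by positivity) ?_
      rw [mul_pow, hb2]
      exact_mod_cast (by simpa [sq, mul_assoc, mul_comm, mul_left_comm] using hc1)
    have hbM : b = M * ‖Literature.Barriers.RiemannHypothesis.smoothSum N (keySet es) ω 1‖ := by
      rw [hb, iB, norm_mul, Complex.norm_natCast, smoothSum_one_eq]
    have h1 : ‖Literature.Barriers.RiemannHypothesis.smoothSum N (keySet es) ω 1‖ < P := by
      refine lt_of_mul_lt_mul_left (a := (W : ℝ) * M) ?_ (by positivity)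
      calc (W : ℝ) * M * ‖Literature.Barriers.RiemannHypothesis.smoothSum N (keySet es) ω 1‖
          = W * b := by rw [hbM]; ring
        _ < Rsum := hWb
        _ ≤ W * M * P := iR
    -- `W > 0`
    have hW : (0 : ℝ) < W := by
      by_contra hW0
      have hW0' : (W : ℝ) = 0 := le_antisymm (not_lt.1 hW0) (by positivity)
      have h0 : (Rsum : ℝ) ≤ 0 := by simpa [hW0'] using iR
      have : (W : ℝ) * b < 0 := hWb.trans_le h0
      rw [hW0', zero_mul] at this
      exact lt_irrefl _ this
    -- (H2)
    have hc2' : 2 * (W : ℝ) * hn ≤ Rsum * hd := by exact_mod_cast hc2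
    have hhd : (0 : ℝ) < hd := by exact_mod_cast ihd
    have hM' : (0 : ℝ) < M := by exact_mod_cast hM
    have h2 : ∀ r ∈ T, 2 * ‖bigCoeff N ω r 1‖ < P := by
      intro r hr
      have hr1 := iH r hr (mem_freePrimes.1 hr).1.2
      -- `M ρ_r < hn/hd ≤ Rsum/(2W) ≤ M P / 2`
      have hq : (hn : ℝ) / hd ≤ Rsum / (2 * W) := by
        rw [div_le_div_iff₀ hhd (by positivity)]
        linarith
      have hq' : (Rsum : ℝ) / (2 * W) ≤ M * P / 2 := by
        rw [div_le_div_iff₀ (by positivity) (by norm_num)]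
        nlinarith [iR]
      have : (M : ℝ) * ‖bigCoeff N ω r 1‖ < M * P / 2 := hr1.trans_le (hq.trans hq')
      nlinarith
    exact exists_zero_of_criterion (S := keySet es) (ω := ω) hSall
      (fun p hp _ ↦ norm_phaseOf hv (List.mem_toFinset.1 hp)) h1 h2

/-- **Soundness of `checkRange`.** [folklore] -/
theorem checkRange_sound (W : ℕ) (es : List (ℕ × ℤ × ℤ × ℕ)) : ∀ len n₀ : ℕ,
    checkRange W es len n₀ = true → ∀ N : ℕ, n₀ ≤ N → N < n₀ + len →
      ∃ s : ℂ, 1 < s.re ∧ zetaPartialSum N s = 0 := by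
  intro len
  induction len with
  | zero => intro n₀ _ N h1 h2; omega
  | succ len ih =>
    intro n₀ h N h1 h2
    rw [checkRange, Bool.and_eq_true, nat_add_eq] at h
    rcases eq_or_lt_of_le h1 with rfl | hlt
    · exact check_sound h.1
    · exact ih (n₀ + 1) h.2 N (by omega) (by omega)

/-- **Soundness of `checkSegs`.** [folklore] -/
theorem checkSegs_sound (W : ℕ) : ∀ segs : List (ℕ × ℕ × List (ℕ × ℤ × ℤ × ℕ)),
    checkSegs W segs = true → ∀ seg ∈ segs, ∀ N : ℕ, seg.1 ≤ N → N < seg.1 + seg.2.1 →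
      ∃ s : ℂ, 1 < s.re ∧ zetaPartialSum N s = 0 := by
  intro segs
  induction segs with
  | nil => intro _ seg hseg; simp at hseg
  | cons sg segs ih =>
    intro h seg hseg N h1 h2
    obtain ⟨n₀, len, es⟩ := sg
    rw [checkSegs, Bool.and_eq_true] at h
    rcases List.mem_cons.1 hseg with rfl | hmem
    · exact checkRange_sound W es len n₀ h.1 N h1 h2
    · exact ih h.2 seg hmem N h1 h2

/-- What `coversGo segs cur hi = true` guarantees: every `N ∈ [cur, hi)` lies in a segment.
[folklore] -/
theorem coversGo_sound : ∀ (segs : List (ℕ × ℕ × List (ℕ × ℤ × ℤ × ℕ))) (cur hi : ℕ),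
    coversGo segs cur hi = true → ∀ N : ℕ, cur ≤ N → N < hi →
      ∃ seg ∈ segs, seg.1 ≤ N ∧ N < seg.1 + seg.2.1 := by
  intro segs
  induction segs with
  | nil =>
    intro cur hi h N h1 h2
    rw [coversGo, ble_true_iff] at h
    omega
  | cons sg segs ih =>
    intro cur hi h N h1 h2
    obtain ⟨n₀, len, es⟩ := sg
    rw [coversGo, Bool.and_eq_true, beq_true_iff, nat_add_eq] at h
    obtain ⟨rfl, h'⟩ := h
    rcases Nat.lt_or_ge N (n₀ + len) with hlt | hge
    · exact ⟨(n₀, len, es), List.mem_cons_self .., h1, hlt⟩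
    · obtain ⟨seg, hseg, hs⟩ := ih (n₀ + len) hi h' N hge h2
      exact ⟨seg, List.mem_cons_of_mem _ hseg, hs⟩

/-- **Certified ranges.** If the segments pass the checker and tile `[lo, hi)`, every `N` with
`lo ≤ N < hi` has a zero of `ζ_N` with `Re s > 1`. [cite: PlattTrudgian2016, §2.2] -/
theorem exists_zero_of_checkSegs {W lo hi : ℕ} {segs : List (ℕ × ℕ × List (ℕ × ℤ × ℤ × ℕ))}
    (h1 : checkSegs W segs = true) (h2 : coversGo segs lo hi = true) :
    ∀ N : ℕ, lo ≤ N → N < hi → ∃ s : ℂ, 1 < s.re ∧ zetaPartialSum N s = 0 := by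
  intro N hlo hhi
  obtain ⟨seg, hseg, hs1, hs2⟩ := coversGo_sound segs lo hi h2 N hlo hhi
  exact checkSegs_sound W segs h1 seg hseg N hs1 hs2

end Literature.Barriers.RiemannHypothesis.TuranCheck
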